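import Literature.NumberTheory.EllipticCurves.Rank1Residual.Typed.VisibilityCertificateMultiplicative
import Literature.NumberTheory.EllipticCurves.Fisher2012.HesseFamilyFiveCongruence
import HarnessLib

/-!
# Rank `0`, `p = 5`: `BSD(E,5)` from a visible element of `Ш(E)[5]` explained by a member of the HESSE PENCIL of `E` (cell `b2b-bsdres`)

HONEST FRAMING (run/shared/lean/b2b/bsd-rank1-residual/, verbatim): the goal of the cell is to
DELETE the COMBINATION-SHAPED residual classes for ALL analytic-rank `≤ 1` elliptic curves over `ℚ`
— "full BSD formula for every rank `≤ 1` curve in class C" assembled STRICTLY from published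
theorems — so that the rank-`≤ 1` remainder becomes exactly the CONSTRUCTION-SHAPED classes, which
are TYPED (missing-input `Prop`s), NOT attempted. This is not "finishing BSD".

Theorems only (no definition, no new named fact in THIS file; prover x11a gen 11). Sequel to
`Typed/VisibilityCertificateMultiplicative.lean` (x11a gen 10: `bsdp_of_wuthrich_of_congr_of_places`,
rank-`0` pair with `p² ‖ #Ш_an` + a `p`-congruent curve `E'` of rank `≥ 1` whose local Kummer
conditions agree with those of `E` off a paid set `T` ⇒ `BSD(E,p)`). There the partner `E'` and the
`Γ_ℚ`-isomorphism `θ : E'[p] ≅ E[p]` are per-curve DATA, and in the cell's censuses `θ` is certified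
by a Sturm-bound congruence of newforms — which needs a partner in a table of modular forms
(Cremona's database, conductor `< 5·10⁵`): 63 of the 158 rank-`0` X11-type pairs with `p ≥ 5`,
`p ∣ #Ш_an`, `N < 5·10⁵` have NO partner of rank `≥ 2` there (gen-10 `g10/p5_status.txt`), 45 of them
at `p = 5`. Here, at `p = 5`, the partner is a member `E_{λ,μ}` (`λ, μ ∈ ℚ`) of the HESSE PENCIL of
`E` (the twist `X_E(5) ≅ ℙ¹` of `X(5)`; formulae of Rubin–Silverberg 1995 / Fisher 2012) or of the
indirect family `X_E^{(2)}(5) ≅ ℙ¹` (Fisher 2013), and `θ` comes from the PUBLISHED theorems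
Fisher 2012 Thm. 13.2 / Fisher 2013 Thm. 5.8 (named facts `Fisher2012.thm132_fiveCongruent_hessePencil`,
`Fisher2012.thm58_fiveCongruent_hessePencilInd`, transported to the minimal model by the PROVED
`Fisher2012.fiveCongruent_hessePencil5{,ind}`): EVERY `E/ℚ` has infinitely many such partners, of any
conductor, so the lever no longer depends on the luck of a database; what remains per pair is to FIND
`(λ : μ)` with `rank E_{λ,μ} ≥ 1 + #T` and the local data — a finite computation (the cell's PARI
jobs, `b2b-bsdres-x11a/REPORT-g11.md`).

* `bsdp_of_wuthrich_of_hessePencil5_of_places` / `…_of_surj` — partner `E_{λ,μ}` in the Hesse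
  pencil (`Fisher2012.hessePencil5 W.c₄ W.c₆ l m`), refined count: pay at `T ⊆ S`, free kinds
  (i)/(ii)/(iii) on `S \ T`;
* `bsdp_of_wuthrich_of_hessePencil5ind_of_places` / `…_of_surj` — partner in the indirect family
  (`Fisher2012.hessePencil5ind W.c₄ W.c₆ l m`);
* `bsdp_of_wuthrich_of_hessePencil3_of_places` / `…_of_surj` — the same at `p = 3` with a member of
  the `n = 3` Hesse pencil `X_E(3) ≅ ℙ¹` (`Fisher2012.hessePencil3`; for x11b's and the X6–X8
  seats' rank-`0` pairs with `9 ‖ #Ш_an`).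

Binders: published `hCT` (Cassels–Tate), `hW` (Wuthrich 2014 Prop. 21), `hGZK`, `hmod`, `hU`/`hU2`
(Silverman ATAEC V Tate uniformisation) as in gen 10, plus `hF` (Fisher 2012 Thm. 13.2) resp. `hF'`
(Fisher 2013 Thm. 5.8) — all PUBLISHED. NOT class theorems (per-curve data `l, m, S, T`, rank and
local certificates); no label changes; the lane certifies.

References: Fisher 2012 Thm. 13.2 [Fisher2012Hessian]; Fisher 2013 Thm. 5.8 [Fisher2013QuinticTwists];
Rubin–Silverberg 1995 [RubinSilverberg1995]; Cremona–Mazur 2000 §3 [CremonaMazur2000]; Wuthrich 2014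
Prop. 21 [Wuthrich2014]; Silverman ATAEC V.3.1, V.5.2–5.4 [SilvermanATAEC1994]; cell files
`Typed/VisibilityCertificateMultiplicative.lean`, `Fisher2012/HesseFamilyFiveCongruence.lean`.
-/

noncomputable section

open scoped Classical

open WeierstrassCurve Literature.NumberTheory.EllipticCurves
  Literature.NumberTheory.EllipticCurves.Rank1Residual
  Literature.NumberTheory.EllipticCurves.Wuthrich2014
  Literature.NumberTheory.EllipticCurves.Fisher2012
open NumberField IsDedekindDomain

namespace Literature.NumberTheory.EllipticCurves.Rank1Residual.Typed

variable (W : WeierstrassCurve ℚ) [W.IsElliptic] [W.IsGloballyMinimal]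

section five

variable [Fact (Nat.Prime 5)]

/-- **Rank `0`, `5` non-additive, surjective-or-Borel image mod `5`, `ord_5 #Ш_an ≤ 2`: `BSD(E,5)`
from PUBLISHED theorems plus a member `E_{λ,μ}` of the HESSE PENCIL of `E` (Fisher 2012 Thm. 13.2 /
Rubin–Silverberg) with enough rank and agreeing local conditions** (refined visibility count of
gen 10; `5 ∤ #E(ℚ)` explicit). Per-curve data: `l, m` (the member, which must be an elliptic
curve), `S`, `T ⊆ S` with `∏_{v ∈ T} #E_{λ,μ}(ℚ_v)[5] · #(ℤ_v/5) < 5^{rank E_{λ,μ}(ℚ)}`, `hS`, and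
`hplaces` (every `v ∈ S \ T` of kind (i) `v ≠ 5`, `E_{λ,μ}(ℚ_v)[5] = 0` / (ii) both split
multiplicative, `#E(ℚ_v)[5] ≤ 5` / (iii) both multiplicative of the same `γ`-class, `μ_5(ℚ_v) = 1`).
Published binders `hCT`, `hW`, `hGZK`, `hmod`, `hU`, `hU2`, `hF`. NOT a class theorem.
[cite: Fisher2012Hessian, Thm. 13.2] [cite: Wuthrich2014, Prop. 21 (p. 400)]
[cite: CremonaMazur2000, §3 and Table 1] [cite: SilvermanATAEC1994, Ch. V Thm. 3.1, Lemma 5.2, Thm. 5.3, Cor. 5.4] -/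
theorem bsdp_of_wuthrich_of_hessePencil5_of_places (hCT : exists_casselsTate_pairing (K := ℚ))
    (hW : sha_dvd_analyticSha) (hGZK : rank_eq_analyticRank_of_analyticRank_le_one)
    (hmod : hasEntireLFunction_rat) (hU : Silverman1994_thmV53_tateUniformisation.{0})
    (hU2 : Silverman1994_thmV53_corV54_tateUniformisation.{0})
    (hF : thm132_fiveCongruent_hessePencil)
    (hr : W.analyticRank = 0)
    (hadd : ¬ ((W.baseChange ℚ_[5]).minimal ℤ_[5]).HasAdditiveReduction ℤ_[5])
    (himg : ¬ W.HasIrreducibleModPGaloisRep 5 ∨ W.HasSurjectiveModNGaloisRep 5)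
    (hcop : (Nat.card W.toAffine.Point).Coprime 5)
    {q : ℚ} (hq : shaAn W = (q : ℂ)) (hv : padicValRat 5 q ≤ 2)
    (l m : ℚ) [(hessePencil5 W.c₄ W.c₆ l m).IsElliptic]
    (S T : Finset (HeightOneSpectrum (𝓞 ℚ))) (hTS : T ⊆ S)
    (hS : ∀ v : HeightOneSpectrum (𝓞 ℚ), v ∉ S →
      W.HasGoodReductionAt v ∧ (hessePencil5 W.c₄ W.c₆ l m).HasGoodReductionAt v ∧
        (5 : 𝓞 ℚ) ∉ v.asIdeal)
    (hT : (∏ v ∈ T, Nat.card (nsmulAddMonoidHom 5 :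
        ((hessePencil5 W.c₄ W.c₆ l m).baseChange (v.adicCompletion ℚ)).toAffine.Point →+ _).ker *
        Nat.card (v.adicCompletionIntegers ℚ ⧸
          Ideal.span {(5 : v.adicCompletionIntegers ℚ)})) <
        5 ^ (hessePencil5 W.c₄ W.c₆ l m).mordellWeilRank)
    (hplaces : ∀ v ∈ S, v ∉ T →
      ((5 : 𝓞 ℚ) ∉ v.asIdeal ∧ Nat.card (nsmulAddMonoidHom 5 :
          ((hessePencil5 W.c₄ W.c₆ l m).baseChange (v.adicCompletion ℚ)).toAffine.Point →+ _).ker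
            = 1) ∨
      (W.HasSplitMultiplicativeReductionAt v ∧
        (hessePencil5 W.c₄ W.c₆ l m).HasSplitMultiplicativeReductionAt v ∧
        Nat.card (nsmulAddMonoidHom 5 :
          (W.baseChange (v.adicCompletion ℚ)).toAffine.Point →+ _).ker ≤ 5) ∨
      (W.HasMultiplicativeReductionAt v ∧
        (hessePencil5 W.c₄ W.c₆ l m).HasMultiplicativeReductionAt v ∧
        (∃ r : v.adicCompletion ℚ, algebraMap ℚ (v.adicCompletion ℚ) (-(W.c₄ / W.c₆)) =
          r ^ 2 * algebraMap ℚ (v.adicCompletion ℚ)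
            (-((hessePencil5 W.c₄ W.c₆ l m).c₄ / (hessePencil5 W.c₄ W.c₆ l m).c₆))) ∧
        (∀ ζ : v.adicCompletion ℚ, ζ ^ 5 = 1 → ζ = 1))) :
    BSDp W 5 := by
  obtain ⟨θ, hθ⟩ := fiveCongruent_hessePencil5 hF W l m
  exact bsdp_of_wuthrich_of_congr_of_places W 5 hCT hW hGZK hmod hU hU2 (by norm_num) hr hadd himg
    hcop hq hv (hessePencil5 W.c₄ W.c₆ l m) θ hθ S T hTS hS hT hplaces

/-- **Rank `0`, `5` non-additive, SURJECTIVE `ρ̄_{E,5}`, `ord_5 #Ш_an ≤ 2`: `BSD(E,5)` from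
PUBLISHED theorems plus a member of the Hesse pencil of `E` with enough rank and agreeing local
conditions**; `5 ∤ #E(ℚ)` automatic. The shape of every open rank-`0` X11-type census pair at
`p = 5` (`25 ‖ #Ш_an`, `ρ̄` surjective). NOT a class theorem.
[cite: Fisher2012Hessian, Thm. 13.2] [cite: Wuthrich2014, Prop. 21 (p. 400)]
[cite: CremonaMazur2000, §3 and Table 1] [cite: Mazur1977, Ch. III §5, p. 157] -/
theorem bsdp_of_wuthrich_of_hessePencil5_of_places_of_surj
    (hCT : exists_casselsTate_pairing (K := ℚ))
    (hW : sha_dvd_analyticSha) (hGZK : rank_eq_analyticRank_of_analyticRank_le_one)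
    (hmod : hasEntireLFunction_rat) (hU : Silverman1994_thmV53_tateUniformisation.{0})
    (hU2 : Silverman1994_thmV53_corV54_tateUniformisation.{0})
    (hF : thm132_fiveCongruent_hessePencil)
    (hr : W.analyticRank = 0)
    (hadd : ¬ ((W.baseChange ℚ_[5]).minimal ℤ_[5]).HasAdditiveReduction ℤ_[5])
    (hsurj : Surj W 5) {q : ℚ} (hq : shaAn W = (q : ℂ)) (hv : padicValRat 5 q ≤ 2)
    (l m : ℚ) [(hessePencil5 W.c₄ W.c₆ l m).IsElliptic]
    (S T : Finset (HeightOneSpectrum (𝓞 ℚ))) (hTS : T ⊆ S)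
    (hS : ∀ v : HeightOneSpectrum (𝓞 ℚ), v ∉ S →
      W.HasGoodReductionAt v ∧ (hessePencil5 W.c₄ W.c₆ l m).HasGoodReductionAt v ∧
        (5 : 𝓞 ℚ) ∉ v.asIdeal)
    (hT : (∏ v ∈ T, Nat.card (nsmulAddMonoidHom 5 :
        ((hessePencil5 W.c₄ W.c₆ l m).baseChange (v.adicCompletion ℚ)).toAffine.Point →+ _).ker *
        Nat.card (v.adicCompletionIntegers ℚ ⧸
          Ideal.span {(5 : v.adicCompletionIntegers ℚ)})) <
        5 ^ (hessePencil5 W.c₄ W.c₆ l m).mordellWeilRank)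
    (hplaces : ∀ v ∈ S, v ∉ T →
      ((5 : 𝓞 ℚ) ∉ v.asIdeal ∧ Nat.card (nsmulAddMonoidHom 5 :
          ((hessePencil5 W.c₄ W.c₆ l m).baseChange (v.adicCompletion ℚ)).toAffine.Point →+ _).ker
            = 1) ∨
      (W.HasSplitMultiplicativeReductionAt v ∧
        (hessePencil5 W.c₄ W.c₆ l m).HasSplitMultiplicativeReductionAt v ∧
        Nat.card (nsmulAddMonoidHom 5 :
          (W.baseChange (v.adicCompletion ℚ)).toAffine.Point →+ _).ker ≤ 5) ∨
      (W.HasMultiplicativeReductionAt v ∧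
        (hessePencil5 W.c₄ W.c₆ l m).HasMultiplicativeReductionAt v ∧
        (∃ r : v.adicCompletion ℚ, algebraMap ℚ (v.adicCompletion ℚ) (-(W.c₄ / W.c₆)) =
          r ^ 2 * algebraMap ℚ (v.adicCompletion ℚ)
            (-((hessePencil5 W.c₄ W.c₆ l m).c₄ / (hessePencil5 W.c₄ W.c₆ l m).c₆))) ∧
        (∀ ζ : v.adicCompletion ℚ, ζ ^ 5 = 1 → ζ = 1))) :
    BSDp W 5 := by
  obtain ⟨θ, hθ⟩ := fiveCongruent_hessePencil5 hF W l m
  exact bsdp_of_wuthrich_of_congr_of_places_of_surj W 5 hCT hW hGZK hmod hU hU2 (by norm_num) hr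
    hadd hsurj hq hv (hessePencil5 W.c₄ W.c₆ l m) θ hθ S T hTS hS hT hplaces

/-- **Rank `0`, `5` non-additive, surjective-or-Borel image mod `5`, `ord_5 #Ш_an ≤ 2`: `BSD(E,5)`
from PUBLISHED theorems plus a member `E_{λ,μ}` of the INDIRECT family `X_E^{(2)}(5)` of `E`
(Fisher 2013 Thm. 5.8) with enough rank and agreeing local conditions** (refined count; `5 ∤ #E(ℚ)`
explicit). NOT a class theorem. [cite: Fisher2013QuinticTwists, Thm. 5.8]
[cite: Wuthrich2014, Prop. 21 (p. 400)] [cite: CremonaMazur2000, §3 and Table 1]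
[cite: SilvermanATAEC1994, Ch. V Thm. 3.1, Lemma 5.2, Thm. 5.3, Cor. 5.4] -/
theorem bsdp_of_wuthrich_of_hessePencil5ind_of_places (hCT : exists_casselsTate_pairing (K := ℚ))
    (hW : sha_dvd_analyticSha) (hGZK : rank_eq_analyticRank_of_analyticRank_le_one)
    (hmod : hasEntireLFunction_rat) (hU : Silverman1994_thmV53_tateUniformisation.{0})
    (hU2 : Silverman1994_thmV53_corV54_tateUniformisation.{0})
    (hF' : thm58_fiveCongruent_hessePencilInd)
    (hr : W.analyticRank = 0)
    (hadd : ¬ ((W.baseChange ℚ_[5]).minimal ℤ_[5]).HasAdditiveReduction ℤ_[5])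
    (himg : ¬ W.HasIrreducibleModPGaloisRep 5 ∨ W.HasSurjectiveModNGaloisRep 5)
    (hcop : (Nat.card W.toAffine.Point).Coprime 5)
    {q : ℚ} (hq : shaAn W = (q : ℂ)) (hv : padicValRat 5 q ≤ 2)
    (l m : ℚ) [(hessePencil5ind W.c₄ W.c₆ l m).IsElliptic]
    (S T : Finset (HeightOneSpectrum (𝓞 ℚ))) (hTS : T ⊆ S)
    (hS : ∀ v : HeightOneSpectrum (𝓞 ℚ), v ∉ S →
      W.HasGoodReductionAt v ∧ (hessePencil5ind W.c₄ W.c₆ l m).HasGoodReductionAt v ∧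
        (5 : 𝓞 ℚ) ∉ v.asIdeal)
    (hT : (∏ v ∈ T, Nat.card (nsmulAddMonoidHom 5 :
        ((hessePencil5ind W.c₄ W.c₆ l m).baseChange (v.adicCompletion ℚ)).toAffine.Point →+ _).ker *
        Nat.card (v.adicCompletionIntegers ℚ ⧸
          Ideal.span {(5 : v.adicCompletionIntegers ℚ)})) <
        5 ^ (hessePencil5ind W.c₄ W.c₆ l m).mordellWeilRank)
    (hplaces : ∀ v ∈ S, v ∉ T →
      ((5 : 𝓞 ℚ) ∉ v.asIdeal ∧ Nat.card (nsmulAddMonoidHom 5 :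
          ((hessePencil5ind W.c₄ W.c₆ l m).baseChange (v.adicCompletion ℚ)).toAffine.Point →+ _).ker
            = 1) ∨
      (W.HasSplitMultiplicativeReductionAt v ∧
        (hessePencil5ind W.c₄ W.c₆ l m).HasSplitMultiplicativeReductionAt v ∧
        Nat.card (nsmulAddMonoidHom 5 :
          (W.baseChange (v.adicCompletion ℚ)).toAffine.Point →+ _).ker ≤ 5) ∨
      (W.HasMultiplicativeReductionAt v ∧
        (hessePencil5ind W.c₄ W.c₆ l m).HasMultiplicativeReductionAt v ∧
        (∃ r : v.adicCompletion ℚ, algebraMap ℚ (v.adicCompletion ℚ) (-(W.c₄ / W.c₆)) =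
          r ^ 2 * algebraMap ℚ (v.adicCompletion ℚ)
            (-((hessePencil5ind W.c₄ W.c₆ l m).c₄ / (hessePencil5ind W.c₄ W.c₆ l m).c₆))) ∧
        (∀ ζ : v.adicCompletion ℚ, ζ ^ 5 = 1 → ζ = 1))) :
    BSDp W 5 := by
  obtain ⟨θ, hθ⟩ := fiveCongruent_hessePencil5ind hF' W l m
  exact bsdp_of_wuthrich_of_congr_of_places W 5 hCT hW hGZK hmod hU hU2 (by norm_num) hr hadd himg
    hcop hq hv (hessePencil5ind W.c₄ W.c₆ l m) θ hθ S T hTS hS hT hplaces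

/-- **Rank `0`, `5` non-additive, SURJECTIVE `ρ̄_{E,5}`, `ord_5 #Ш_an ≤ 2`: `BSD(E,5)` from
PUBLISHED theorems plus a member of the indirect family `X_E^{(2)}(5)` with enough rank and agreeing
local conditions**; `5 ∤ #E(ℚ)` automatic. NOT a class theorem.
[cite: Fisher2013QuinticTwists, Thm. 5.8] [cite: Wuthrich2014, Prop. 21 (p. 400)]
[cite: CremonaMazur2000, §3 and Table 1] [cite: Mazur1977, Ch. III §5, p. 157] -/
theorem bsdp_of_wuthrich_of_hessePencil5ind_of_places_of_surj
    (hCT : exists_casselsTate_pairing (K := ℚ))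
    (hW : sha_dvd_analyticSha) (hGZK : rank_eq_analyticRank_of_analyticRank_le_one)
    (hmod : hasEntireLFunction_rat) (hU : Silverman1994_thmV53_tateUniformisation.{0})
    (hU2 : Silverman1994_thmV53_corV54_tateUniformisation.{0})
    (hF' : thm58_fiveCongruent_hessePencilInd)
    (hr : W.analyticRank = 0)
    (hadd : ¬ ((W.baseChange ℚ_[5]).minimal ℤ_[5]).HasAdditiveReduction ℤ_[5])
    (hsurj : Surj W 5) {q : ℚ} (hq : shaAn W = (q : ℂ)) (hv : padicValRat 5 q ≤ 2)
    (l m : ℚ) [(hessePencil5ind W.c₄ W.c₆ l m).IsElliptic]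
    (S T : Finset (HeightOneSpectrum (𝓞 ℚ))) (hTS : T ⊆ S)
    (hS : ∀ v : HeightOneSpectrum (𝓞 ℚ), v ∉ S →
      W.HasGoodReductionAt v ∧ (hessePencil5ind W.c₄ W.c₆ l m).HasGoodReductionAt v ∧
        (5 : 𝓞 ℚ) ∉ v.asIdeal)
    (hT : (∏ v ∈ T, Nat.card (nsmulAddMonoidHom 5 :
        ((hessePencil5ind W.c₄ W.c₆ l m).baseChange (v.adicCompletion ℚ)).toAffine.Point →+ _).ker *
        Nat.card (v.adicCompletionIntegers ℚ ⧸
          Ideal.span {(5 : v.adicCompletionIntegers ℚ)})) <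
        5 ^ (hessePencil5ind W.c₄ W.c₆ l m).mordellWeilRank)
    (hplaces : ∀ v ∈ S, v ∉ T →
      ((5 : 𝓞 ℚ) ∉ v.asIdeal ∧ Nat.card (nsmulAddMonoidHom 5 :
          ((hessePencil5ind W.c₄ W.c₆ l m).baseChange (v.adicCompletion ℚ)).toAffine.Point →+ _).ker
            = 1) ∨
      (W.HasSplitMultiplicativeReductionAt v ∧
        (hessePencil5ind W.c₄ W.c₆ l m).HasSplitMultiplicativeReductionAt v ∧
        Nat.card (nsmulAddMonoidHom 5 :
          (W.baseChange (v.adicCompletion ℚ)).toAffine.Point →+ _).ker ≤ 5) ∨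
      (W.HasMultiplicativeReductionAt v ∧
        (hessePencil5ind W.c₄ W.c₆ l m).HasMultiplicativeReductionAt v ∧
        (∃ r : v.adicCompletion ℚ, algebraMap ℚ (v.adicCompletion ℚ) (-(W.c₄ / W.c₆)) =
          r ^ 2 * algebraMap ℚ (v.adicCompletion ℚ)
            (-((hessePencil5ind W.c₄ W.c₆ l m).c₄ / (hessePencil5ind W.c₄ W.c₆ l m).c₆))) ∧
        (∀ ζ : v.adicCompletion ℚ, ζ ^ 5 = 1 → ζ = 1))) :
    BSDp W 5 := by
  obtain ⟨θ, hθ⟩ := fiveCongruent_hessePencil5ind hF' W l m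
  exact bsdp_of_wuthrich_of_congr_of_places_of_surj W 5 hCT hW hGZK hmod hU hU2 (by norm_num) hr
    hadd hsurj hq hv (hessePencil5ind W.c₄ W.c₆ l m) θ hθ S T hTS hS hT hplaces

end five

/-! ### `p = 3`: partners from the `n = 3` Hesse pencil (Fisher 2012 Thm. 13.2, `n = 3`)

For the cell's `p = 3` rank-`0` pairs with `9 ‖ #Ш_an` (X11 at `p = 3`, X6/X7/X8; x11b's and the
X6–X8 seats' certificates): the same consumer with the partner a member of `X_E(3) ≅ ℙ¹`. -/

section three

variable [Fact (Nat.Prime 3)]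

/-- **Rank `0`, `3` non-additive, surjective-or-Borel image mod `3`, `ord_3 #Ш_an ≤ 2`: `BSD(E,3)`
from PUBLISHED theorems plus a member `E_{λ,μ}` of the `n = 3` HESSE PENCIL of `E` (Fisher 2012
Thm. 13.2, `n = 3`) with enough rank and agreeing local conditions** (refined count; `3 ∤ #E(ℚ)`
explicit). NOT a class theorem. [cite: Fisher2012Hessian, Thm. 13.2 (n = 3)]
[cite: Wuthrich2014, Prop. 21 (p. 400)] [cite: CremonaMazur2000, §3 and Table 1]
[cite: SilvermanATAEC1994, Ch. V Thm. 3.1, Lemma 5.2, Thm. 5.3, Cor. 5.4] -/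
theorem bsdp_of_wuthrich_of_hessePencil3_of_places (hCT : exists_casselsTate_pairing (K := ℚ))
    (hW : sha_dvd_analyticSha) (hGZK : rank_eq_analyticRank_of_analyticRank_le_one)
    (hmod : hasEntireLFunction_rat) (hU : Silverman1994_thmV53_tateUniformisation.{0})
    (hU2 : Silverman1994_thmV53_corV54_tateUniformisation.{0})
    (hF : thm132_threeCongruent_hessePencil)
    (hr : W.analyticRank = 0)
    (hadd : ¬ ((W.baseChange ℚ_[3]).minimal ℤ_[3]).HasAdditiveReduction ℤ_[3])
    (himg : ¬ W.HasIrreducibleModPGaloisRep 3 ∨ W.HasSurjectiveModNGaloisRep 3)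
    (hcop : (Nat.card W.toAffine.Point).Coprime 3)
    {q : ℚ} (hq : shaAn W = (q : ℂ)) (hv : padicValRat 3 q ≤ 2)
    (l m : ℚ) [(hessePencil3 W.c₄ W.c₆ l m).IsElliptic]
    (S T : Finset (HeightOneSpectrum (𝓞 ℚ))) (hTS : T ⊆ S)
    (hS : ∀ v : HeightOneSpectrum (𝓞 ℚ), v ∉ S →
      W.HasGoodReductionAt v ∧ (hessePencil3 W.c₄ W.c₆ l m).HasGoodReductionAt v ∧
        (3 : 𝓞 ℚ) ∉ v.asIdeal)
    (hT : (∏ v ∈ T, Nat.card (nsmulAddMonoidHom 3 :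
        ((hessePencil3 W.c₄ W.c₆ l m).baseChange (v.adicCompletion ℚ)).toAffine.Point →+ _).ker *
        Nat.card (v.adicCompletionIntegers ℚ ⧸
          Ideal.span {(3 : v.adicCompletionIntegers ℚ)})) <
        3 ^ (hessePencil3 W.c₄ W.c₆ l m).mordellWeilRank)
    (hplaces : ∀ v ∈ S, v ∉ T →
      ((3 : 𝓞 ℚ) ∉ v.asIdeal ∧ Nat.card (nsmulAddMonoidHom 3 :
          ((hessePencil3 W.c₄ W.c₆ l m).baseChange (v.adicCompletion ℚ)).toAffine.Point →+ _).ker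
            = 1) ∨
      (W.HasSplitMultiplicativeReductionAt v ∧
        (hessePencil3 W.c₄ W.c₆ l m).HasSplitMultiplicativeReductionAt v ∧
        Nat.card (nsmulAddMonoidHom 3 :
          (W.baseChange (v.adicCompletion ℚ)).toAffine.Point →+ _).ker ≤ 3) ∨
      (W.HasMultiplicativeReductionAt v ∧
        (hessePencil3 W.c₄ W.c₆ l m).HasMultiplicativeReductionAt v ∧
        (∃ r : v.adicCompletion ℚ, algebraMap ℚ (v.adicCompletion ℚ) (-(W.c₄ / W.c₆)) =
          r ^ 2 * algebraMap ℚ (v.adicCompletion ℚ)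
            (-((hessePencil3 W.c₄ W.c₆ l m).c₄ / (hessePencil3 W.c₄ W.c₆ l m).c₆))) ∧
        (∀ ζ : v.adicCompletion ℚ, ζ ^ 3 = 1 → ζ = 1))) :
    BSDp W 3 := by
  obtain ⟨θ, hθ⟩ := threeCongruent_hessePencil3 hF W l m
  exact bsdp_of_wuthrich_of_congr_of_places W 3 hCT hW hGZK hmod hU hU2 (by norm_num) hr hadd himg
    hcop hq hv (hessePencil3 W.c₄ W.c₆ l m) θ hθ S T hTS hS hT hplaces

/-- **Rank `0`, `3` non-additive, SURJECTIVE `ρ̄_{E,3}`, `ord_3 #Ш_an ≤ 2`: `BSD(E,3)` from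
PUBLISHED theorems plus a member of the `n = 3` Hesse pencil of `E` with enough rank and agreeing
local conditions**; `3 ∤ #E(ℚ)` automatic. NOT a class theorem.
[cite: Fisher2012Hessian, Thm. 13.2 (n = 3)] [cite: Wuthrich2014, Prop. 21 (p. 400)]
[cite: CremonaMazur2000, §3 and Table 1] [cite: Mazur1977, Ch. III §5, p. 157] -/
theorem bsdp_of_wuthrich_of_hessePencil3_of_places_of_surj
    (hCT : exists_casselsTate_pairing (K := ℚ))
    (hW : sha_dvd_analyticSha) (hGZK : rank_eq_analyticRank_of_analyticRank_le_one)
    (hmod : hasEntireLFunction_rat) (hU : Silverman1994_thmV53_tateUniformisation.{0})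
    (hU2 : Silverman1994_thmV53_corV54_tateUniformisation.{0})
    (hF : thm132_threeCongruent_hessePencil)
    (hr : W.analyticRank = 0)
    (hadd : ¬ ((W.baseChange ℚ_[3]).minimal ℤ_[3]).HasAdditiveReduction ℤ_[3])
    (hsurj : Surj W 3) {q : ℚ} (hq : shaAn W = (q : ℂ)) (hv : padicValRat 3 q ≤ 2)
    (l m : ℚ) [(hessePencil3 W.c₄ W.c₆ l m).IsElliptic]
    (S T : Finset (HeightOneSpectrum (𝓞 ℚ))) (hTS : T ⊆ S)
    (hS : ∀ v : HeightOneSpectrum (𝓞 ℚ), v ∉ S →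
      W.HasGoodReductionAt v ∧ (hessePencil3 W.c₄ W.c₆ l m).HasGoodReductionAt v ∧
        (3 : 𝓞 ℚ) ∉ v.asIdeal)
    (hT : (∏ v ∈ T, Nat.card (nsmulAddMonoidHom 3 :
        ((hessePencil3 W.c₄ W.c₆ l m).baseChange (v.adicCompletion ℚ)).toAffine.Point →+ _).ker *
        Nat.card (v.adicCompletionIntegers ℚ ⧸
          Ideal.span {(3 : v.adicCompletionIntegers ℚ)})) <
        3 ^ (hessePencil3 W.c₄ W.c₆ l m).mordellWeilRank)
    (hplaces : ∀ v ∈ S, v ∉ T →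
      ((3 : 𝓞 ℚ) ∉ v.asIdeal ∧ Nat.card (nsmulAddMonoidHom 3 :
          ((hessePencil3 W.c₄ W.c₆ l m).baseChange (v.adicCompletion ℚ)).toAffine.Point →+ _).ker
            = 1) ∨
      (W.HasSplitMultiplicativeReductionAt v ∧
        (hessePencil3 W.c₄ W.c₆ l m).HasSplitMultiplicativeReductionAt v ∧
        Nat.card (nsmulAddMonoidHom 3 :
          (W.baseChange (v.adicCompletion ℚ)).toAffine.Point →+ _).ker ≤ 3) ∨
      (W.HasMultiplicativeReductionAt v ∧
        (hessePencil3 W.c₄ W.c₆ l m).HasMultiplicativeReductionAt v ∧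
        (∃ r : v.adicCompletion ℚ, algebraMap ℚ (v.adicCompletion ℚ) (-(W.c₄ / W.c₆)) =
          r ^ 2 * algebraMap ℚ (v.adicCompletion ℚ)
            (-((hessePencil3 W.c₄ W.c₆ l m).c₄ / (hessePencil3 W.c₄ W.c₆ l m).c₆))) ∧
        (∀ ζ : v.adicCompletion ℚ, ζ ^ 3 = 1 → ζ = 1))) :
    BSDp W 3 := by
  obtain ⟨θ, hθ⟩ := threeCongruent_hessePencil3 hF W l m
  exact bsdp_of_wuthrich_of_congr_of_places_of_surj W 3 hCT hW hGZK hmod hU hU2 (by norm_num) hr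
    hadd hsurj hq hv (hessePencil3 W.c₄ W.c₆ l m) θ hθ S T hTS hS hT hplaces

end three

end Literature.NumberTheory.EllipticCurves.Rank1Residual.Typed
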